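import Literature.NumberTheory.EllipticCurves.WeierstrassCubicForm
import Literature.AlgebraicGeometry.Motives.SmoothHypersurfaceIrreducible
import Literature.AlgebraicGeometry.Motives.VarietiesGeometricallyIntegralProofs
import Literature.AlgebraicGeometry.Motives.VarietiesProperProofs
import HarnessLib

/-!
# The Weierstrass plane cubic `E_W = V₊(F) ⊂ ℙ²_K` as a `K`-scheme

For a Weierstrass curve `W` over a field `K` with homogeneous cubic
`F = Y²Z + a₁XYZ + a₃YZ² − (X³ + a₂X²Z + a₄XZ² + a₆Z³)` (Mathlib
`WeierstrassCurve.Projective.polynomial`; `Literature/NumberTheory/EllipticCurves/WeierstrassCubicForm`),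
this file constructs the plane cubic `E_W = V₊(F) ⊂ ℙ²_K` **as a scheme over `K`** — the closed
subscheme of `ℙ²_K = Proj K[X, Y, Z]` with its reduced induced structure on the closed set
`V₊(F)`, i.e. the tree's `Literature.AlgebraicGeometry.Motives.SmoothHypersurface.hypersurface F`
(Hartshorne II Example 3.2.6) for `n = 1` — and records what the tree's hypersurface machinery
gives for it:

* `WeierstrassCurve.scheme W : SchemeOver K` and the closed `K`-immersion
  `WeierstrassCurve.schemeι W : W.scheme ⟶ projectiveSpace 2 K` onto `V₊(F)` (`range_schemeι`);
  `E_W` is projective, hence **proper** over `K` (`isProper_scheme_hom`, Hartshorne II 4.9), and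
  **geometrically irreducible** (`geometricallyIrreducible_scheme_hom`: `F` is absolutely
  irreducible, `WeierstrassCurve.Projective.irreducible_map_polynomial`, and Hartshorne II Ex. 3.15)
  — for *every* Weierstrass equation, singular or not;
* for `W` elliptic (`Δ ≠ 0`): `F` is a nonsingular form
  (`WeierstrassCurve.Projective.isNonsingularForm_polynomial`, Silverman III.1.4), so by the
  projective Jacobian criterion (Hartshorne I Ex. 5.8 / III 10.2, the tree's
  `SmoothHypersurface.smoothOfRelativeDimension_hypersurface_hom`) `E_W → Spec K` is **smooth of
  relative dimension `1`** (`smoothOfRelativeDimension_scheme_hom`); hence `E_W` is a smooth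
  projective geometrically integral curve over `K` (`isSmoothProjective_scheme`,
  `geometricallyIntegral_scheme_hom`, `isIntegral_scheme_left`). This is Silverman, *AEC*,
  III.3.1(c): "every smooth cubic curve given by a Weierstrass equation is an elliptic curve
  defined over `K`", at the level of the underlying `K`-scheme.

What is **not** here: the group law `E_W ×_K E_W → E_W` as a morphism (AEC III.3.6), the
identification of `E_W(L)` with Mathlib's `W⟮L⟯`, and hence the `AbelianVariety` structure; they
are the subject of later files (`nonempty_abelianVarietyBridgeFull`).

## References

* [SilvermanAEC2009] J. H. Silverman, *The Arithmetic of Elliptic Curves*, 2nd ed., GTM 106,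
  Springer 2009: III.1 Prop. 1.4, III.3.1(c).
* [Hartshorne1977] R. Hartshorne, *Algebraic Geometry*, GTM 52 (1977): I Ex. 5.8, II Example
  3.2.6, II Thm. 4.9, II Ex. 3.15, III Thm. 10.2.

## Design notes

`namespace WeierstrassCurve` (deliberate dot-notation extensions of Mathlib's structure, as in the
other elliptic-curve preludes of this directory); `K : Type u` and `SchemeOver K : Type (u+1)` as in
`Literature.AlgebraicGeometry.Motives.AbelianVariety`. `W.scheme` is *definitionally*
`SmoothHypersurface.hypersurface (n := 1) W.toProjective.polynomial` (`scheme_def`), so every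
chart-level statement of `Motives/SmoothHypersurfaceScheme` applies verbatim.
-/

noncomputable section

open CategoryTheory AlgebraicGeometry Literature.AlgebraicGeometry.Motives

universe u

namespace WeierstrassCurve

variable {K : Type u} [Field K] (W : WeierstrassCurve K)

attribute [local instance] MvPolynomial.gradedAlgebra

/-- **The Weierstrass plane cubic as a `K`-scheme**: `E_W = V₊(F) ⊂ ℙ²_K` with its reduced
induced closed-subscheme structure, `F` the homogeneous Weierstrass cubic of `W`
(Silverman, *AEC*, III.1 and III.3.1(c); Hartshorne II Example 3.2.6). Implemented as the tree's
`SmoothHypersurface.hypersurface` for `n = 1`. [cite: SilvermanAEC2009, III.3.1(c)] -/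
def scheme : SchemeOver K :=
  SmoothHypersurface.hypersurface (k := K) (n := 1) W.toProjective.polynomial

/-- The closed immersion `E_W ↪ ℙ²_K` over `K`. [cite: SilvermanAEC2009, III.3.1(c)] -/
def schemeι : W.scheme ⟶ projectiveSpace 2 K :=
  SmoothHypersurface.hypersurfaceι (k := K) (n := 1) W.toProjective.polynomial

/-- Unfolding: `W.scheme` is the reduced hypersurface of the Weierstrass cubic (`rfl`). [folklore] -/
theorem scheme_def :
    W.scheme = SmoothHypersurface.hypersurface (k := K) (n := 1) W.toProjective.polynomial :=
  rfl

/-- Unfolding: `W.schemeι` is the hypersurface inclusion (`rfl`). [folklore] -/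
theorem schemeι_def :
    W.schemeι = SmoothHypersurface.hypersurfaceι (k := K) (n := 1) W.toProjective.polynomial :=
  rfl

/-- `E_W ↪ ℙ²_K` is a closed immersion. [folklore] -/
instance isClosedImmersion_schemeι_left : IsClosedImmersion W.schemeι.left :=
  SmoothHypersurface.isClosedImmersion_hypersurfaceι_left _

/-- The image of `E_W ↪ ℙ²_K` is the closed set `V₊(F)` of the Weierstrass cubic. [folklore] -/
theorem range_schemeι :
    Set.range W.schemeι.left =
      ProjectiveSpectrum.zeroLocus (MvPolynomial.homogeneousSubmodule (Fin 3) K)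
        {W.toProjective.polynomial} :=
  SmoothHypersurface.range_hypersurfaceι _

/-- The structure morphism of `E_W` factors as `E_W ↪ ℙ²_K → Spec K`. [folklore] -/
theorem schemeι_comp_hom : W.schemeι.left ≫ (projectiveSpace 2 K).hom = W.scheme.hom :=
  Over.w W.schemeι

/-- `E_W` is projective over `K`. [folklore] -/
theorem isProjectiveOver_scheme : IsProjectiveOver W.scheme :=
  SmoothHypersurface.isProjectiveOver_hypersurface _

/-- `E_W → Spec K` is proper (projective ⇒ proper, Hartshorne II Thm. 4.9).
[cite: Hartshorne1977, II Thm. 4.9] -/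
instance isProper_scheme_hom : IsProper W.scheme.hom :=
  W.isProjectiveOver_scheme.isProper

/-- `E_W → Spec K` is geometrically irreducible, for every Weierstrass equation: the Weierstrass
cubic is absolutely irreducible (`WeierstrassCurve.Projective.irreducible_map_polynomial`) and the
hypersurface of an absolutely irreducible form is geometrically irreducible (Hartshorne II Ex. 3.15,
the tree's `SmoothHypersurface.geometricallyIrreducible_hypersurface_hom`).
[cite: Hartshorne1977, II Ex. 3.15] -/
instance geometricallyIrreducible_scheme_hom : GeometricallyIrreducible W.scheme.hom :=
  SmoothHypersurface.geometricallyIrreducible_hypersurface_hom (n := 1) W.toProjective.polynomial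
    W.toProjective.isHomogeneous_polynomial
    fun L _ _ => W.toProjective.irreducible_map_polynomial (algebraMap K L)

/-- `E_W` is irreducible. [folklore] -/
instance irreducibleSpace_scheme_left : IrreducibleSpace W.scheme.left :=
  GeometricallyIrreducible.irreducibleSpace_of_subsingleton W.scheme.hom

section Elliptic

variable [W.IsElliptic]

/-- For an elliptic curve, `Δ ≠ 0` (Mathlib `IsElliptic`, over a field). [folklore] -/
theorem Δ_ne_zero_of_isElliptic : W.Δ ≠ 0 :=
  W.coe_Δ' ▸ W.Δ'.ne_zero

/-- **`E_W → Spec K` is smooth of relative dimension `1`** for `W` elliptic: the Weierstrass cubic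
is then a nonsingular form (Silverman III.1.4, `isNonsingularForm_polynomial`) and the projective
Jacobian criterion applies (Hartshorne I Ex. 5.8 with III Thm. 10.2; the tree's
`SmoothHypersurface.smoothOfRelativeDimension_hypersurface_hom`). This is AEC III.3.1(c) ("every
smooth cubic curve given by a Weierstrass equation is an elliptic curve") for the `K`-scheme `E_W`.
[cite: SilvermanAEC2009, III.3.1(c)] -/
instance smoothOfRelativeDimension_scheme_hom : SmoothOfRelativeDimension 1 W.scheme.hom :=
  SmoothHypersurface.smoothOfRelativeDimension_hypersurface_hom (n := 1) W.toProjective.polynomial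
    W.toProjective.isHomogeneous_polynomial
    (W.toProjective.isNonsingularForm_polynomial W.Δ_ne_zero_of_isElliptic) (by norm_num)

/-- `E_W → Spec K` is smooth. [folklore] -/
instance smooth_scheme_hom : Smooth W.scheme.hom :=
  SmoothOfRelativeDimension.smooth 1 W.scheme.hom

/-- **`E_W` is a smooth projective geometrically irreducible curve over `K`** (`IsSmoothProjective 1`
of `Motives/Varieties`), for `W` elliptic. [cite: SilvermanAEC2009, III.3.1(c)] -/
theorem isSmoothProjective_scheme : IsSmoothProjective 1 W.scheme :=
  ⟨W.smoothOfRelativeDimension_scheme_hom, W.isProjectiveOver_scheme,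
    W.geometricallyIrreducible_scheme_hom⟩

/-- `E_W → Spec K` is geometrically integral (smooth ⇒ geometrically reduced, Stacks 056T, plus
geometric irreducibility): the hypothesis of `Literature.AlgebraicGeometry.Motives.AbelianVariety`.
[folklore] -/
instance geometricallyIntegral_scheme_hom : GeometricallyIntegral W.scheme.hom :=
  IsSmoothProjective.geometricallyIntegral_holds W.isSmoothProjective_scheme

/-- `E_W` is an integral scheme. [folklore] -/
instance isIntegral_scheme_left : IsIntegral W.scheme.left :=
  IsSmoothProjective.isIntegral_holds W.isSmoothProjective_scheme

/-- `E_W` is reduced. [folklore] -/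
theorem isReduced_scheme_left : IsReduced W.scheme.left :=
  inferInstance

end Elliptic

end WeierstrassCurve
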